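import Literature.AnabelianGeometry.EtaleTheta.ThetaCoversAxioms
import Literature.AnabelianGeometry.EtaleTheta.ThetaCoversHeisenbergGroup
import Mathlib.Algebra.Group.PUnit
import Mathlib.Algebra.BigOperators.Intervals

/-!
# A kernel NON-VACUITY witness for the theta-covering interface `CoverDataAx` ([EtTh] §2, pp.35–38)

Mochizuki, *The Étale Theta Function and its Frobenioid-theoretic Manifestations* [EtTh], Publ. RIMS
45 (2009), §2, Def 2.1 – Prop 2.2, PRIMS text pp.35–38 (bib key `MochizukiEtTh2009`).

CONSISTENCY WITNESS, TOY — consistency ≠ faithfulness; nothing here takes a side on anything printed.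
The interface `ThetaCovers.CoverData l` / `ThetaCovers.CoverDataAx l` (seat abc-iut-L2-t2) over which
[EtTh] Rmk 2.1.1 and Prop 2.2 (i)–(iii) are DISCHARGED (`CoverDataAx.rmk211_holds`,
`CoverDataAx.prop22_i_holds`, `prop22_ii_holds`, `prop22_iii_holds`; FACT-LIST rows F-0596 – F-0599) had
no kernel inhabitant.  This file builds one for EVERY odd `l`, the finite **Heisenberg toy**:

* `Π_C := (ℤ/l × ℤ/l) ⋊ D_l` (`heisPiC`, file `ThetaCoversHeisenbergGroup.lean`): the dihedral group
  `D_l = ⟨r, s⟩` acts on pairs `(b, c)` by `r^i · (b, c) = (b, c + i b)`, `s r^i · (b, c) = (−b, c + i b)`; so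
  `Π_X := (ℤ/l × ℤ/l) ⋊ ⟨r⟩` (`heisPiX`, index `2`) is the mod-`l` HEISENBERG group of order `l³`
  (coordinates `a` = rotation index, `b`, `c`), playing `Δ_X = Π_X` with `G_K := 1` (`PUnit`),
  `Ker(Δ_X ↠ Δ̄_X) := 1`, `Δ̄_Θ := {(0, c)} = centre = ⁅Δ_X, Δ_X⁆` (`heisTheta`), `D_x := Δ̄_Θ`, and the
  reflections `s r^i` are the inversions: they act by `−1` on `Δ̄^ell_X = Δ̄_X/Δ̄_Θ ≅ (ℤ/l)²`
  (coordinates `a, b`) and by `+1` on `Δ̄_Θ`; discrete topology.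
* `heisenbergWitness l : CoverDataAx l` — all 20-odd axioms of the interface hold in this model
  (`Odd l` is the only input), so the axiom system is consistent and the four discharged statements
  are not vacuously true-by-inconsistency.
* Sequel `ThetaCoversHeisenbergWitnessProp22.lean`: explicit `Π_C̲ := (ℤ/l × ℤ/l) ⋊ {1, s}`, `ι := s`,
  `E := {(b, 0)}`, `S := 1` inhabiting `IsTypeLTorsPm`, `IsInversion`, `IsMinusEigen`, `IsSplitting`, so
  that the hypotheses of the typed Prop 2.2 (i)(ii)(iii) are themselves inhabited and the discharged
  theorems SPECIALISE to statements about this finite group; and `⁅Δ_X, Δ_X⁆ · Ker = Δ̄_Θ` in the toy.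

Interface repair R1 (abc-iut-L2-lead 02:06:46Z / 02:14:09Z / 05:31Z, finding F1 of abc-iut-L2-d3, GAP-LEDGER
G-L2d3-5: the v1/v2 field "`Ker(Δ_X ↠ Δ̄_X)` open in `Π_C`" forces `G_K` finite and becomes "closed in `Π_C`" in
`ThetaCovers.lean` v3): in this DISCRETE toy every subgroup is open AND closed; v1.5 of this file (abc-iut-L2-d3,
transitional, same mathematics) hands the `CoverData` fields to the constructor positionally with a clopen
term in that slot, so that the witness elaborates unchanged against both interface versions.

What this does NOT show: faithfulness of the interface to print (in print `Δ_X` is free profinite of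
rank 2 and `G_K = Gal(K̄/K)`); that is the referee lanes' business. abc-iut cell, seat abc-iut-w5-d243
(finding NV-L2-d243-1). [cite: MochizukiEtTh2009, Def 2.1 p.36] [cite: MochizukiEtTh2009, Prop 2.2 p.37]
-/

namespace Literature.AnabelianGeometry.EtaleTheta

namespace ThetaCovers

namespace HeisenbergWitness

open Multiplicative

variable (l : ℕ)

/-! ## 2. The subgroups `Π_X`, `Δ̄_Θ` and the witness -/

/-- **`Π_X` of the toy**: the elements whose `D_l`-component is a rotation (the mod-`l` Heisenberg
group `(ℤ/l × ℤ/l) ⋊ ⟨r⟩` of order `l³`). (toy bookkeeping for the typed interface of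
[EtTh] Def 2.1 / Prop 2.2; no claim about print) [cite: MochizukiEtTh2009, Def 2.1 p.36] -/
def heisPiX : Subgroup (heisPiC l) := ((sgn l).comp SemidirectProduct.rightHom).ker

/-- Membership in `Π_X`: the `D_l`-component is a rotation. (toy bookkeeping for the typed interface of
[EtTh] Def 2.1 / Prop 2.2; no claim about print) [cite: MochizukiEtTh2009, Def 2.1 p.36] -/
theorem mem_heisPiX {x : heisPiC l} : x ∈ heisPiX l ↔ ∃ i, x.right = DihedralGroup.r i := by
  rw [heisPiX, MonoidHom.mem_ker, MonoidHom.comp_apply, SemidirectProduct.rightHom_eq_right]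
  exact sgn_eq_one_iff l x.right

/-- **`Δ̄_Θ`-preimage of the toy** (also `D_x` and the centre of `Π_X`): `{(0, c)} ⋊ 1`. (toy bookkeeping for the typed interface of
[EtTh] Def 2.1 / Prop 2.2; no claim about print) [cite: MochizukiEtTh2009, Def 2.1 p.36] -/
def heisTheta : Subgroup (heisPiC l) where
  carrier := {x | x.right = 1 ∧ β l x = 0}
  mul_mem' := by
    rintro a b ⟨ha1, ha2⟩ ⟨hb1, hb2⟩
    exact ⟨by simp [ha1, hb1], by simp [ha2, hb2]⟩
  one_mem' := ⟨rfl, β_one l⟩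
  inv_mem' := by
    rintro a ⟨ha1, ha2⟩
    exact ⟨by simp [ha1], by simp [ha2]⟩

/-- Membership in `Δ̄_Θ`. (toy bookkeeping for the typed interface of
[EtTh] Def 2.1 / Prop 2.2; no claim about print) [cite: MochizukiEtTh2009, Def 2.1 p.36] -/
theorem mem_heisTheta {x : heisPiC l} : x ∈ heisTheta l ↔ x.right = 1 ∧ β l x = 0 := Iff.rfl

/-- `Δ̄_Θ ⊆ Π_X`. (toy bookkeeping for the typed interface of
[EtTh] Def 2.1 / Prop 2.2; no claim about print) [cite: MochizukiEtTh2009, Def 2.1 p.36] -/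
theorem heisTheta_le_heisPiX : heisTheta l ≤ heisPiX l := fun x hx =>
  (mem_heisPiX l).mpr ⟨0, by rw [(mem_heisTheta l).mp hx |>.1, DihedralGroup.one_def]⟩

/-- `Δ̄_Θ` is normal in `Π_C`. (toy bookkeeping for the typed interface of
[EtTh] Def 2.1 / Prop 2.2; no claim about print) [cite: MochizukiEtTh2009, Def 2.1 p.36] -/
theorem heisTheta_normal : (heisTheta l).Normal := by
  refine ⟨fun t ht g => ?_⟩
  obtain ⟨ht1, ht2⟩ := (mem_heisTheta l).mp ht
  refine ⟨by simp [ht1], ?_⟩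
  rcases hg : g.right with i | i <;> simp [ht1, ht2, hg]

/-- The embedding `c ↦ (0, c)` of `ℤ/l` onto `Δ̄_Θ`. (toy bookkeeping for the typed interface of
[EtTh] Def 2.1 / Prop 2.2; no claim about print) [cite: MochizukiEtTh2009, Def 2.1 p.36] -/
def thetaEmb : Multiplicative (ZMod l) →* heisPiC l :=
  SemidirectProduct.inl.comp (AddMonoidHom.toMultiplicative (AddMonoidHom.inr (ZMod l) (ZMod l)))

/-- `Δ̄_Θ` is the image of `thetaEmb`. (toy bookkeeping for the typed interface of
[EtTh] Def 2.1 / Prop 2.2; no claim about print) [cite: MochizukiEtTh2009, Def 2.1 p.36] -/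
theorem heisTheta_eq_range : heisTheta l = (thetaEmb l).range := by
  ext x
  rw [mem_heisTheta, MonoidHom.mem_range]
  constructor
  · rintro ⟨h1, h2⟩
    refine ⟨ofAdd (γ l x), ext_of_coords l ?_ ?_ ?_⟩
    · simpa [thetaEmb] using h1.symm
    · simpa [thetaEmb] using h2.symm
    · simp [thetaEmb, γ]
  · rintro ⟨c, rfl⟩
    exact ⟨rfl, rfl⟩

/-- `thetaEmb` is injective. (toy bookkeeping for the typed interface of
[EtTh] Def 2.1 / Prop 2.2; no claim about print) [cite: MochizukiEtTh2009, Def 2.1 p.36] -/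
theorem thetaEmb_injective : Function.Injective (thetaEmb l) := by
  intro a b h
  have := congrArg (γ l) h
  simpa [thetaEmb, γ] using this

/-- `|Δ̄_Θ| = l`. (toy bookkeeping for the typed interface of
[EtTh] Def 2.1 / Prop 2.2; no claim about print) [cite: MochizukiEtTh2009, Def 2.1 p.36] -/
theorem card_heisTheta : Nat.card (heisTheta l) = l := by
  rw [heisTheta_eq_range, ← Nat.card_congr (MonoidHom.ofInjective (thetaEmb_injective l)).toEquiv,
    Nat.card_congr (Multiplicative.toAdd : Multiplicative (ZMod l) ≃ ZMod l), Nat.card_zmod]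

/-- `[Π_C : Π_X] = 2`. (toy bookkeeping for the typed interface of
[EtTh] Def 2.1 / Prop 2.2; no claim about print) [cite: MochizukiEtTh2009, Def 2.1 p.36] -/
theorem index_heisPiX : (heisPiX l).index = 2 := by
  have hsurj : Function.Surjective ((sgn l).comp (SemidirectProduct.rightHom (φ := theta l))) := by
    intro y
    obtain ⟨a, rfl⟩ := Multiplicative.ofAdd.surjective y
    fin_cases a
    · exact ⟨SemidirectProduct.inr (DihedralGroup.r 0), rfl⟩
    · exact ⟨SemidirectProduct.inr (DihedralGroup.sr 0), rfl⟩
  rw [heisPiX, Subgroup.index_ker, MonoidHom.range_eq_top.mpr hsurj, Subgroup.card_top,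
    Nat.card_eq_fintype_card, Fintype.card_multiplicative, ZMod.card]

/-- The abelianisation coordinates `(b, a)` on `Π_X` (a homomorphism to `(ℤ/l)²`, kernel `Δ̄_Θ`) —
the typed "`Δ̄^ell_X` is a free `(ℤ/lℤ)`-module of rank `2`". (toy bookkeeping for the typed interface of
[EtTh] Def 2.1 / Prop 2.2; no claim about print) [cite: MochizukiEtTh2009, Def 2.1 p.36] -/
def ellCoords : ↥(heisPiX l ⊓ (1 : heisPiC l →* PUnit).ker) →* Multiplicative (ZMod l × ZMod l) where
  toFun x := ofAdd (β l x.1, rotIdx l x.1.right)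
  map_one' := by
    apply toAdd.injective
    simp only [OneMemClass.coe_one, β_one, SemidirectProduct.one_right, rotIdx_one, toAdd_ofAdd,
      toAdd_one]
    rfl
  map_mul' x y := by
    obtain ⟨i, hi⟩ := (mem_heisPiX l).mp x.2.1
    obtain ⟨j, hj⟩ := (mem_heisPiX l).mp y.2.1
    apply toAdd.injective
    simp [hi, hj, toAdd_mul]

/-- `ellCoords` is surjective. (toy bookkeeping for the typed interface of
[EtTh] Def 2.1 / Prop 2.2; no claim about print) [cite: MochizukiEtTh2009, Def 2.1 p.36] -/
theorem ellCoords_surjective : Function.Surjective (ellCoords l) := by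
  intro y
  obtain ⟨⟨b, a⟩, rfl⟩ := Multiplicative.ofAdd.surjective y
  refine ⟨⟨⟨ofAdd (b, 0), DihedralGroup.r a⟩, (mem_heisPiX l).mpr ⟨a, rfl⟩, rfl⟩, ?_⟩
  apply toAdd.injective
  simp only [ellCoords, MonoidHom.coe_mk, OneHom.coe_mk, toAdd_ofAdd, rotIdx_r]
  rfl

/-- `Ker(ellCoords) = Δ̄_Θ`. (toy bookkeeping for the typed interface of
[EtTh] Def 2.1 / Prop 2.2; no claim about print) [cite: MochizukiEtTh2009, Def 2.1 p.36] -/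
theorem ellCoords_ker : (ellCoords l).ker = (heisTheta l).subgroupOf _ := by
  ext x
  obtain ⟨i, hi⟩ := (mem_heisPiX l).mp x.2.1
  rw [MonoidHom.mem_ker, Subgroup.mem_subgroupOf, mem_heisTheta]
  constructor
  · intro h
    have h' := congrArg toAdd h
    simp only [ellCoords, MonoidHom.coe_mk, OneHom.coe_mk, toAdd_ofAdd, toAdd_one, hi, rotIdx_r,
      Prod.mk_eq_zero] at h'
    refine ⟨?_, h'.1⟩
    rw [hi, h'.2]
    rfl
  · rintro ⟨h1, h2⟩
    rw [hi, DihedralGroup.one_def, DihedralGroup.r.injEq] at h1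
    apply toAdd.injective
    simp only [ellCoords, MonoidHom.coe_mk, OneHom.coe_mk, toAdd_ofAdd, toAdd_one, hi, rotIdx_r, h1,
      h2]
    rfl

/-- For `l` odd, `∑_{j<l} j = 0` in `ℤ/l`. (toy bookkeeping for the typed interface of
[EtTh] Def 2.1 / Prop 2.2; no claim about print) [cite: MochizukiEtTh2009, Def 2.1 p.36] -/
theorem sum_range_cast_eq_zero (hl : Odd l) : (∑ j ∈ Finset.range l, (j : ZMod l)) = 0 := by
  have h2 : IsUnit (2 : ZMod l) := by
    have := (ZMod.isUnit_iff_coprime 2 l).mpr (Nat.coprime_two_left.mpr hl)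
    exact_mod_cast this
  have key : (∑ j ∈ Finset.range l, (j : ZMod l)) * 2 = 0 := by
    have h := congrArg (fun n : ℕ => (n : ZMod l)) (Finset.sum_range_id_mul_two l)
    simp only [Nat.cast_mul, Nat.cast_sum, Nat.cast_ofNat, ZMod.natCast_self, zero_mul] at h
    exact h
  exact (h2.mul_left_eq_zero).mp key

/-- Powers in `Π_X`: coordinates of `d^k` for `d` with rotation component `r^a`. (toy bookkeeping for the typed interface of
[EtTh] Def 2.1 / Prop 2.2; no claim about print) [cite: MochizukiEtTh2009, Def 2.1 p.36] -/
theorem coords_pow {d : heisPiC l} {a : ZMod l} (hd : d.right = DihedralGroup.r a) (k : ℕ) :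
    (d ^ k).right = DihedralGroup.r (a * (k : ZMod l)) ∧ β l (d ^ k) = (k : ZMod l) * β l d ∧
      γ l (d ^ k) = (k : ZMod l) * γ l d + a * β l d * ∑ j ∈ Finset.range k, (j : ZMod l) := by
  induction k with
  | zero =>
    refine ⟨?_, by simp, by simp⟩
    rw [pow_zero, Nat.cast_zero, mul_zero]
    rfl
  | succ k ih =>
    obtain ⟨h1, h2, h3⟩ := ih
    refine ⟨?_, ?_, ?_⟩
    · rw [pow_succ, SemidirectProduct.mul_right, h1, hd, DihedralGroup.r_mul_r, Nat.cast_succ, mul_add,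
        mul_one]
    · rw [pow_succ, β_mul, h1, h2, eps_r, Nat.cast_succ]; ring
    · rw [pow_succ, γ_mul, h1, h3, rotIdx_r, Finset.sum_range_succ, Nat.cast_succ]; ring

/-- `Π_X` has exponent `l` (`l` odd): `d^l = 1`. (toy bookkeeping for the typed interface of
[EtTh] Def 2.1 / Prop 2.2; no claim about print) [cite: MochizukiEtTh2009, Def 2.1 p.36] -/
theorem pow_eq_one (hl : Odd l) {d : heisPiC l} (hd : d ∈ heisPiX l) : d ^ l = 1 := by
  obtain ⟨a, ha⟩ := (mem_heisPiX l).mp hd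
  obtain ⟨h1, h2, h3⟩ := coords_pow l ha l
  refine eq_one_of_coords l ?_ ?_ ?_
  · rw [h1, DihedralGroup.one_def, ZMod.natCast_self, mul_zero]
  · rw [h2, ZMod.natCast_self, zero_mul]
  · rw [h3, sum_range_cast_eq_zero l hl, ZMod.natCast_self]; ring

/-- Everything lies in the kernel of the trivial augmentation `Π_C → G_K = 1`. (toy bookkeeping for the typed interface of
[EtTh] Def 2.1 / Prop 2.2; no claim about print) [cite: MochizukiEtTh2009, Def 2.1 p.36] -/
theorem mem_ker_one (x : heisPiC l) : x ∈ (1 : heisPiC l →* PUnit).ker :=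
  MonoidHom.mem_ker.mpr (Subsingleton.elim _ _)

/-- **THE NON-VACUITY WITNESS**: the Heisenberg toy is a `CoverDataAx l` for every odd `l` (discrete
topology, `G_K = 1`, `Ker(Δ_X ↠ Δ̄_X) = 1`, `D_x = Δ̄_Θ`). CONSISTENCY WITNESS ONLY — not a claim of
faithfulness to print. [cite: MochizukiEtTh2009, Def 2.1 p.36] -/
@[reducible] def heisenbergWitness (hl : Odd l) : CoverDataAx.{0} l :=
  letI : TopologicalSpace (heisPiC l) := ⊥
  haveI : DiscreteTopology (heisPiC l) := ⟨rfl⟩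
  { -- v1.5 (interface repair G-L2d3-5, transitional): the `CoverData` part is given to the constructor
    -- POSITIONALLY, so that no field is referred to by name; the one slot whose name and type change
    -- between `ThetaCovers.lean` v2 (`IsOpen (barKer : Set Π_C)`) and v3 (`IsClosed (barKer : Set Π_C)`)
    -- is filled by a term elaborating against either (a subset of a discrete space is clopen).
    -- Order of the explicit fields: l_odd, Π_C, G_K, aug, Π_X, Π_X normal, [Π_C : Π_X] = 2, Π_X open,
    -- aug|Π_X onto, Ker, Ker normal, ⟨topology of Ker⟩, Δ̄_Θ-preimage, its normality, Ker ≤ it,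
    -- it ≤ Δ_X, [it : Ker] = l, rank two, centrality, D_x, D_x ≤ Π_X, aug|D_x onto, inertia.
    toCoverData :=
      ⟨hl, heisPiC l, PUnit, 1, heisPiX l, MonoidHom.normal_ker _, index_heisPiX l, isOpen_discrete _,
        fun _ => ⟨1, Subsingleton.elim _ _⟩, ⊥, inferInstance,
        by obtain ⟨_, _⟩ := isClopen_discrete (((⊥ : Subgroup (heisPiC l)) : Set (heisPiC l))); assumption,
        heisTheta l, heisTheta_normal l, bot_le,
        by rw [MonoidHom.ker_one, inf_top_eq]; exact heisTheta_le_heisPiX l,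
        by rw [Subgroup.relIndex_bot_left, card_heisTheta],
        by
          haveI := heisTheta_normal l
          exact ⟨(QuotientGroup.quotientMulEquivOfEq (ellCoords_ker l).symm).trans
            (QuotientGroup.quotientKerEquivOfSurjective _ (ellCoords_surjective l))⟩,
        by
          intro t ht d hd
          rw [MonoidHom.ker_one, inf_top_eq] at hd
          obtain ⟨ht1, ht2⟩ := (mem_heisTheta l).mp ht
          obtain ⟨i, hi⟩ := (mem_heisPiX l).mp hd
          rw [Subgroup.mem_bot]
          refine eq_one_of_coords l ?_ ?_ ?_
          · simp [ht1]
          · simp [ht1, ht2, hi]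
          · simp [ht1, ht2, hi],
        heisTheta l, heisTheta_le_heisPiX l, fun _ => ⟨1, Subsingleton.elim _ _⟩,
        by rw [MonoidHom.ker_one, inf_top_eq, sup_bot_eq]⟩
    pow_mem_barKer := by
      intro d hd
      rw [MonoidHom.ker_one, inf_top_eq] at hd
      rw [Subgroup.mem_bot]
      exact pow_eq_one l hl hd
    inv_ell := by
      intro c _ hc d hd
      rw [MonoidHom.ker_one, inf_top_eq] at hd
      obtain ⟨i, hi⟩ := (mem_heisPiX l).mp hd
      have hc' : ∃ j, c.right = DihedralGroup.sr j := by
        rcases h : c.right with j | j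
        · exact absurd ((mem_heisPiX l).mpr ⟨j, h⟩) hc
        · exact ⟨j, rfl⟩
      obtain ⟨j, hj⟩ := hc'
      refine (mem_heisTheta l).mpr ⟨?_, ?_⟩
      · rw [SemidirectProduct.mul_right, SemidirectProduct.mul_right, SemidirectProduct.mul_right,
          SemidirectProduct.inv_right, hi, hj, DihedralGroup.inv_sr, DihedralGroup.sr_mul_r,
          DihedralGroup.sr_mul_sr, DihedralGroup.r_mul_r, DihedralGroup.one_def]
        exact congrArg DihedralGroup.r (by ring)
      · simp [hi, hj]
    inv_theta := by
      intro c _ hc t ht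
      obtain ⟨ht1, ht2⟩ := (mem_heisTheta l).mp ht
      have hc' : ∃ j, c.right = DihedralGroup.sr j := by
        rcases h : c.right with j | j
        · exact absurd ((mem_heisPiX l).mpr ⟨j, h⟩) hc
        · exact ⟨j, rfl⟩
      obtain ⟨j, hj⟩ := hc'
      rw [Subgroup.mem_bot]
      refine eq_one_of_coords l ?_ ?_ ?_
      · simp [ht1, hj]
      · simp [ht1, ht2, hj]
      · simp [ht1, ht2, hj] }

end HeisenbergWitness

end ThetaCovers

end Literature.AnabelianGeometry.EtaleTheta
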